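import Mathlib
import HarnessLib
import Summits.NavierStokesRegularity.NavierStokesRegularity.Theorems.HalfSpaceWindowDoorCirculationCarryingRigidityAngularFluxHourglass

/-!
# Route `HalfSpaceWindowDoor`, crux `CirculationCarryingRigidity` (stmt-NavierStokesRegularity-25311) —
# line `angular_flux` (LEAD ns-hsw-p1 g13): the hourglass model's angular-momentum flux is LEDGER-SPARSE —
# `∫₀ᴿ |S(r,z,t)| dr ≤ Φ(4+36θ²)·log(1 + (1+9θ²)R²/((4+36θ²)τ))`, `τ = −t + θ²z²`

For a door-class profile the far-past energy ledger `∫_{B_R}‖v‖² ≤ K R` (crux 14060, line `ledger`) bounds the plane-by-plane `L¹`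
norm of the radial angular-momentum flux: `∫∫ |S| dr dz ≤ ∫∮|v_r v_θ| dl dr dz ≤ ∫_{B}‖v‖² ≲ R`.  The model flux of
`…AngularFluxTightness` (`S = −r⁻¹∫₀ʳρQ`, `|S| ≤ Φ(1+9θ²)r/τ` and `≤ Φ(4+36θ²)/r`) passes the plane-by-plane shadow of this
test: by the harmonic-mean majorant `min(Ar/τ, B/r) ≤ 2ABr/(Ar² + Bτ)`,
`∫₀ᴿ |S(r,z,t)| dr ≤ B log(1 + AR²/(Bτ))` (`A = Φ(1+9θ²)`, `B = Φ(4+36θ²)`), which is `≤ B log(1 + (A/B)R²/(θ²z²))` — of size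
`log(R/|θ z|)` on the loaded planes `|z| ≲ R/|θ|` and `O(R²/z²)` beyond, so that the window integral `∫_{|z−z₀|<R}` is `O(R)`
(`∫_ℝ log(1+κ²/z²) dz = 2πκ`, `κ = R√(A/B)/|θ|`; paper-level remark, the `z`-integration is not typed here).  The columnar case
`θ = 0` gives `2R·B log(1 + AR²/(B(−t))) ≠ O(R)`, matching `…Ledger.not_columnar'`.

Seat ns-hsw-p1 g13, `--supports stmt-NavierStokesRegularity-25311 --as helper`.  WHAT THIS IS NOT: not about NS regularity; calculus
of an explicit model flux; nothing is closed by this file.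
-/

noncomputable section

-- the summit and its single sub-problem share the name (CONVENTIONS §1), as in every Theorems file
set_option linter.dupNamespace false

namespace Summit.NavierStokesRegularity.NavierStokesRegularity.Theorems.HalfSpaceWindowDoorCirculationCarryingRigidityAngularFluxLedger

open Set Filter Topology intervalIntegral MeasureTheory
open Summit.NavierStokesRegularity.NavierStokesRegularity.Theorems.HalfSpaceWindowDoorCirculationCarryingRigidityAngularFluxHourglass

/-- Harmonic-mean majorant: if `0 ≤ x ≤ p` and `x ≤ q` with `p, q > 0` then `x ≤ 2pq/(p+q)`. -/
theorem le_harmonic {x p q : ℝ} (hp : 0 < p) (hq : 0 < q) (h1 : x ≤ p) (h2 : x ≤ q) : x ≤ 2 * p * q / (p + q) := by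
  rw [le_div_iff₀ (by positivity)]
  nlinarith [mul_le_mul_of_nonneg_left h1 hq.le, mul_le_mul_of_nonneg_left h2 hp.le]

/-- `∫₀ᴿ 2ABr/(Ar² + Bτ) dr = B log(1 + AR²/(Bτ))` (`A ≥ 0`, `B, τ > 0`). -/
theorem integral_harmonic_majorant {A B τ : ℝ} (hA : 0 ≤ A) (hB : 0 < B) (hτ : 0 < τ) (R : ℝ) :
    ∫ r in (0 : ℝ)..R, 2 * A * B * r / (A * r ^ 2 + B * τ) = B * Real.log (1 + A * R ^ 2 / (B * τ)) := by
  have hpos : ∀ r : ℝ, 0 < A * r ^ 2 + B * τ := fun r => by positivity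
  have hF : ∀ r : ℝ, HasDerivAt (fun r' => B * Real.log (A * r' ^ 2 + B * τ)) (2 * A * B * r / (A * r ^ 2 + B * τ)) r :=
    fun r => by
    have h1 : HasDerivAt (fun r' => A * r' ^ 2 + B * τ) (A * (2 * r)) r := by
      simpa using ((hasDerivAt_pow 2 r).const_mul A).add_const (B * τ)
    refine ((h1.log (hpos r).ne').const_mul B).congr_deriv ?_
    field_simp
  have hc : Continuous fun r : ℝ => 2 * A * B * r / (A * r ^ 2 + B * τ) :=
    Continuous.div (by fun_prop) (by fun_prop) fun r => (hpos r).ne'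
  rw [integral_eq_sub_of_hasDerivAt (fun r _ => hF r) (hc.intervalIntegrable _ _)]
  simp only [ne_eq, OfNat.ofNat_ne_zero, not_false_eq_true, zero_pow, mul_zero, zero_add]
  rw [← mul_sub, ← Real.log_div (hpos R).ne' (by positivity)]
  congr 1
  field_simp
  ring

/-- **Per-plane `L¹` bound of the model flux (ledger sparsity).**  For `Φ > 0`, `t < 0`, `R ≥ 0`, every height `z`
(`τ = −t + θ²z²`, `A = Φ(1+9θ²)`, `B = Φ(4+36θ²)`):
`∫₀ᴿ |S(r,z,t)| dr ≤ B·log(1 + AR²/(Bτ))`, where `S = −r⁻¹∫₀ʳρQ` is the flux of `…AngularFluxTightness`. -/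
theorem flux_L1_le {Φ : ℝ} (hΦ : 0 < Φ) (θ z : ℝ) {t : ℝ} (ht : t < 0) {R : ℝ} (hR : 0 ≤ R) :
    ∫ r in (0 : ℝ)..R, |-(∫ ρ in (0 : ℝ)..r, ρ * (Φ * ρ ^ 2 * Real.exp (-(ρ ^ 2) / (4 * (-t + θ ^ 2 * z ^ 2)))
          / (2 * (-t + θ ^ 2 * z ^ 2) ^ 2) * (1 + θ ^ 2 + θ ^ 4 * z ^ 2 * ρ ^ 2 / (2 * (-t + θ ^ 2 * z ^ 2) ^ 2)
            - 4 * θ ^ 4 * z ^ 2 / (-t + θ ^ 2 * z ^ 2)))) / r|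
      ≤ Φ * (4 + 36 * θ ^ 2)
          * Real.log (1 + Φ * (1 + 9 * θ ^ 2) * R ^ 2 / (Φ * (4 + 36 * θ ^ 2) * (-t + θ ^ 2 * z ^ 2))) := by
  have hτ := tau_pos θ z ht
  set τ := -t + θ ^ 2 * z ^ 2 with hτdef
  set A := Φ * (1 + 9 * θ ^ 2) with hA
  set B := Φ * (4 + 36 * θ ^ 2) with hB
  have hA0 : 0 < A := by positivity
  have hB0 : 0 < B := by positivity
  set f := fun ρ : ℝ => ρ * (Φ * ρ ^ 2 * Real.exp (-(ρ ^ 2) / (4 * τ)) / (2 * τ ^ 2)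
      * (1 + θ ^ 2 + θ ^ 4 * z ^ 2 * ρ ^ 2 / (2 * τ ^ 2) - 4 * θ ^ 4 * z ^ 2 / τ)) with hf
  have hfc : Continuous f := continuous_rhoQ Φ θ z t
  have hI : ∀ r : ℝ, HasDerivAt (fun r' => ∫ ρ in (0 : ℝ)..r', f ρ) (f r) r :=
    fun r => (hfc.integral_hasStrictDerivAt 0 r).hasDerivAt
  -- pointwise majorant on `[0, R]`
  have hpt : ∀ r ∈ Icc (0 : ℝ) R, |-(∫ ρ in (0 : ℝ)..r, f ρ) / r| ≤ 2 * A * B * r / (A * r ^ 2 + B * τ) := by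
    intro r hr
    rcases hr.1.eq_or_lt with h0 | hpos
    · rw [← h0]; simp
    obtain ⟨h1, h2⟩ := abs_fluxIntegral_le hΦ.le θ z ht hpos.le
    rw [abs_div, abs_neg, abs_of_pos hpos]
    have hp : |∫ ρ in (0 : ℝ)..r, f ρ| / r ≤ A * r / τ := by
      calc _ ≤ A * r ^ 2 / τ / r := div_le_div_of_nonneg_right h2 hpos.le
        _ = A * r / τ := by field_simp
    have hq : |∫ ρ in (0 : ℝ)..r, f ρ| / r ≤ B / r := div_le_div_of_nonneg_right h1 hpos.le
    calc _ ≤ 2 * (A * r / τ) * (B / r) / (A * r / τ + B / r) := le_harmonic (by positivity) (by positivity) hp hq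
      _ = 2 * A * B * r / (A * r ^ 2 + B * τ) := by field_simp
  -- integrability of `|S|` on `[0, R]`: continuous on `(0, R]`, bounded by the (continuous) majorant
  have hmajc : Continuous fun r : ℝ => 2 * A * B * r / (A * r ^ 2 + B * τ) :=
    Continuous.div (by fun_prop) (by fun_prop) fun r => by positivity
  have hSc : ContinuousOn (fun r : ℝ => |-(∫ ρ in (0 : ℝ)..r, f ρ) / r|) (Set.uIoc 0 R) := by
    intro r hr
    rw [Set.uIoc_of_le hR] at hr
    exact (((hI r).continuousAt.neg.div continuousAt_id hr.1.ne').abs).continuousWithinAt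
  have hSi : IntervalIntegrable (fun r : ℝ => |-(∫ ρ in (0 : ℝ)..r, f ρ) / r|) volume 0 R := by
    refine (hmajc.intervalIntegrable 0 R).mono_fun' (hSc.aestronglyMeasurable measurableSet_uIoc) ?_
    rw [EventuallyLE, ae_restrict_iff' measurableSet_uIoc]
    refine Eventually.of_forall fun r hr => ?_
    rw [Set.uIoc_of_le hR] at hr
    rw [Real.norm_eq_abs, abs_abs]
    exact hpt r ⟨hr.1.le, hr.2⟩
  calc ∫ r in (0 : ℝ)..R, |-(∫ ρ in (0 : ℝ)..r, f ρ) / r|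
      ≤ ∫ r in (0 : ℝ)..R, 2 * A * B * r / (A * r ^ 2 + B * τ) :=
        intervalIntegral.integral_mono_on hR hSi (hmajc.intervalIntegrable _ _) hpt
    _ = B * Real.log (1 + A * R ^ 2 / (B * τ)) := integral_harmonic_majorant hA0.le hB0 hτ R

end Summit.NavierStokesRegularity.NavierStokesRegularity.Theorems.HalfSpaceWindowDoorCirculationCarryingRigidityAngularFluxLedger

end
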